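import Summits.Langlands.Langlands.Theorems.IrreducibilityBySelfDualityIrreducibleOffSectorRankTwoRational
import Summits.Langlands.Langlands.Theorems.IrreducibilityBySelfDualityIrreducibleOffSectorCharacterFactor
import Literature.NumberTheory.Automorphic.PairLFunctionPolesRepDataRankTwo
import HarnessLib

/-!
# Reducible avatars of cuspidal `π` have a NON-automorphic constituent of rank `≥ 2`; no abelian avatars
(crux stmt-Langlands-14329 `IrreducibilityBySelfDuality.IrreducibleOffSector`, line `Sketch`;
`--supports` file, STRUCTURAL: imports `Summits.Langlands.Langlands.Statement` + landed support modules +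
Literature only; continuation lead c8, CONSTITUENT package)

The crux ("cuspidal ⇒ every a.e.-compatible `ρ` irreducible", Ramakrishnan's expectation) is open in
rank `≥ 3`.  This file locates, in EVERY rank and over EVERY number field, where a failure would have to
live.  Let `π` be a cuspidal datum on `GL_n(𝔸_K)` (`n ≥ 1`; NO archimedean, algebraicity or regularity
hypothesis), `ι : ℚ̄_ℓ ≃ ℂ`, and `ρ : Γ_K → GL_n(ℚ̄_ℓ)` Satake–Frobenius compatible with `(π, ι)` at
almost all places and `E`-RATIONAL at almost all places (Frobenius polynomials over a number field
`E →+* ℚ̄_ℓ` — automatic for L-arithmetic `π`, `eventually_rational_of_esymm_mem`, hence for regular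
L-algebraic `π` by Clozel, `exists_heckeField_of_isLAlgebraic_of_isRegular`).  Suppose the characteristic
polynomials of `ρ` factor through `k ≥ 2` framed representations `r_i : Γ_K → GL_{m_i}(ℚ̄_ℓ)`,
`m_i ≥ 1`: `det(X - ρ σ) = ∏ᵢ det(X - r_i σ)` for all `σ` (e.g. the Jordan–Hölder constituents of `ρ`,
or the diagonal blocks of any block-triangular conjugate).

* `exists_block_not_weaklyAutomorphic_of_rational` (T2) — granted Böckle–Hui 2025 Thm. 1.1 in its
  cofinite `GL(1)` form (the TEXT of the route item `WeakAbelianSummandHecke`, a theorem of the tree),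
  Arthur–Clozel (2.2) for Borel–Jacquet data, and (2.3) for pairs of cuspidal data in the block ranks
  `m_i ≥ 3` only (ranks `≤ 2` are theorems of the tree: Hecke, and
  `JacquetShalika1981_partialPairL_pole_repData_rank_of_le_two`): SOME block `r_i` of rank `m_i ≥ 2` is
  NOT weakly automorphic — no cuspidal datum on `GL_{m_i}(𝔸_K)` is Satake–Frobenius compatible with
  `(r_i, ι)` at almost all places.  In words: the rank-one constituents of a compatible `E`-rational
  avatar come for free (they are unramified wherever `ρ` is, `eq_one_of_charpoly_dvd`, and weakly divide
  a continuous semisimplification of `ρ`, so Böckle–Hui attaches cuspidal `GL(1)` data to them), and if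
  ALL constituents were weakly automorphic the Satake family of `π` would almost everywhere be the union
  of `k ≥ 2` cuspidal Satake families, which Jacquet–Shalika's isobaric rigidity forbids
  (`isobaricRigidity_of_JS_of_rank`).  So the obstruction to the crux is exactly an irreducible
  constituent of dimension `≥ 2` that is not (weakly) automorphic — Fontaine–Mazur–Langlands in ranks
  `2 ≤ m < n`, for constituents only.
* `not_charpoly_eq_prod_rank_one_of_rational` (T1) — the case `k = n`, all `m_i = 1`: for `n ≥ 2` NO
  compatible `E`-rational `ρ` has `det(X - ρ σ) = ∏ᵢ det(X - χ_i σ)` for continuous characters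
  `χ_i : Γ_K → GL_1(ℚ̄_ℓ)`; i.e. no avatar of a cuspidal `π` has ABELIAN semisimplification (modulo
  Böckle–Hui 1.1 and (2.2) only).  This is the rank-`n` form of Ribet's rank-two argument
  (`isIrreducible_rank_two_of_rational`, p117233, is the case `n = 2`).

References: G. Böckle, C.-Y. Hui, *Weak abelian direct summands and irreducibility of Galois
representations*, Math. Ann. 393 (2025), Thm. 1.1, §3.2.1; K. Ribet, *Galois representations attached to
eigenforms with Nebentypus*, LNM 601 (1977), Thm. 2.3; H. Jacquet, J. Shalika, *On Euler products and
the classification of automorphic forms* II, Amer. J. Math. 103 (1981), Thm. 4.4; J. Arthur, L. Clozel,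
Ann. of Math. Stud. 120 (1989), Ch. 3 §2 (2.2)–(2.4); F. Calegari, T. Gee, Ann. Inst. Fourier 63 (2013), §1.1.
-/

noncomputable section

set_option linter.dupNamespace false

open scoped NumberField Classical Polynomial Topology
open Filter IsDedekindDomain Polynomial NumberField
open Literature.NumberTheory.Automorphic Literature.NumberTheory.GaloisRepresentations
open Summit.Langlands

namespace Summit.Langlands.Langlands.Theorems.IrreducibleOffSector

/-! ### Rank-one blocks are weakly automorphic (Böckle–Hui) -/

/-- **A rank-one block of a compatible `E`-rational avatar is attached to a cuspidal `GL(1)` datum.**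
Grant Böckle–Hui 2025 Thm. 1.1 in cofinite `GL(1)` form (`hWA`, the text of the route item
`WeakAbelianSummandHecke`).  Let `ρ : Γ_K → GL_n(ℚ̄_ℓ)` be unramified almost everywhere, `rs` a
continuous semisimplification of `ρ` (same characteristic polynomials, `ker ρ ≤ ker rs`) that is
`E`-rational almost everywhere, and `r : Γ_K → GL_d(ℚ̄_ℓ)` a block of nominal rank `d = 1` whose
characteristic polynomials divide those of `ρ`.  Then `r` is unramified wherever `ρ` is
(`eq_one_of_charpoly_dvd`) and weakly divides `rs`, so Böckle–Hui attaches a cuspidal datum `σ` on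
`GL_d(𝔸_K)` that is Satake–Frobenius compatible with `(r, ι)` at almost all places.  (Stated for a
block of rank `d` with `d = 1` so that it applies to the members of a dependent family of blocks.)
[cite: BockleHui2025, Theorem 1.1 and §3.2.1] -/
theorem exists_cuspidal_compatible_of_rank_eq_one
    (hWA : ∀ (K : Type) [Field K] [NumberField K] (h1 : isCompact_glFiniteIntegralLevel 1 K) (ℓ : ℕ) [Fact ℓ.Prime] (n : ℕ) (E : Type) [Field E] [NumberField E] (e : E →+* PadicAlgCl ℓ) (ρ : Literature.NumberTheory.GaloisRepresentations.FramedGaloisRep K (PadicAlgCl ℓ) n), ρ.toGaloisRep.IsSemisimple → (∀ᶠ v in cofinite, ρ.IsUnramifiedAt v ∧ ∃ P : Polynomial E, ρ.HasFrobCharpolyAt v (P.map e)) → ∀ (ψ : Literature.NumberTheory.GaloisRepresentations.FramedGaloisRep K (PadicAlgCl ℓ) 1), (∀ᶠ v in cofinite, ρ.IsUnramifiedAt v ∧ ψ.IsUnramifiedAt v ∧ ∀ 𝔓 ∈ v.primesAbove, ∀ σ : Field.absoluteGaloisGroup K, IsArithFrobAt (NumberField.RingOfIntegers K) σ 𝔓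 → ψ.charpoly σ ∣ ρ.charpoly σ) → ∀ (ι : PadicAlgCl ℓ ≃+* ℂ), ∃ χ : Literature.NumberTheory.Automorphic.CuspidalAutomorphicRepData 1 K h1, χ.1.IsRegularAlgebraic ∧ ∀ᶠ v in cofinite, ∃ c : ℂ, χ.1.HasSatakeParamAt v {c} ∧ ψ.IsUnramifiedAt v ∧ ψ.HasFrobCharpolyAt v (Literature.NumberTheory.Automorphic.arithFrobPolyOfSatake ι v.residueCard 1 {c}))
    {K : Type} [Field K] [NumberField K] {ℓ : ℕ} [Fact ℓ.Prime] {n : ℕ}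
    {E : Type} [Field E] [NumberField E] (e : E →+* PadicAlgCl ℓ)
    (ρ rs : FramedGaloisRep K (PadicAlgCl ℓ) n) (hss : rs.toGaloisRep.IsSemisimple)
    (hrcp : ∀ g, FramedRep.charpoly rs g = FramedRep.charpoly ρ g) (hrker : ∀ g, ρ g = 1 → rs g = 1)
    (hrrat : ∀ᶠ v : HeightOneSpectrum (𝓞 K) in cofinite,
      rs.IsUnramifiedAt v ∧ ∃ P : Polynomial E, rs.HasFrobCharpolyAt v (P.map e))
    (hunr : ∀ᶠ v : HeightOneSpectrum (𝓞 K) in cofinite, ρ.IsUnramifiedAt v)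
    {d : ℕ} (hd : d = 1) (hdK : isCompact_glFiniteIntegralLevel d K)
    (r : FramedGaloisRep K (PadicAlgCl ℓ) d) (hdvd : ∀ g, r.charpoly g ∣ ρ.charpoly g)
    (ι : PadicAlgCl ℓ ≃+* ℂ) :
    ∃ σ : CuspidalAutomorphicRepData d K hdK,
      ∀ᶠ v : HeightOneSpectrum (𝓞 K) in cofinite, SatakeFrobCompatibleAt ι σ.1 r v := by
  subst hd
  have hdiv : ∀ᶠ v : HeightOneSpectrum (𝓞 K) in cofinite, rs.IsUnramifiedAt v ∧ r.IsUnramifiedAt v ∧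
      ∀ 𝔓 ∈ v.primesAbove, ∀ σ : Field.absoluteGaloisGroup K, IsArithFrobAt (𝓞 K) σ 𝔓 →
        r.charpoly σ ∣ rs.charpoly σ := by
    filter_upwards [hunr] with v hv
    refine ⟨fun 𝔓 h𝔓 σ hσ => hrker σ (hv 𝔓 h𝔓 σ hσ),
      fun 𝔓 h𝔓 σ hσ => eq_one_of_charpoly_dvd ρ r (hv 𝔓 h𝔓 σ hσ) (hdvd σ), fun 𝔓 _ σ _ => ?_⟩
    rw [hrcp σ]
    exact hdvd σ
  obtain ⟨χ, -, hχ⟩ := hWA K hdK ℓ n E e rs hss hrrat r hdiv ι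
  exact ⟨χ, hχ.mono fun v ⟨c, hc, hur, hcp⟩ => ⟨{c}, hc, hur, hcp⟩⟩

/-! ### T2: some block of rank `≥ 2` is not weakly automorphic -/

/-- **Reducible `E`-rational avatars of a cuspidal `π` have a non-automorphic constituent of rank `≥ 2`**
(every rank `n ≥ 1`, every number field `K`, EVERY cuspidal `π` — no archimedean hypothesis).  Grant
Böckle–Hui 2025 Thm. 1.1 in cofinite `GL(1)` form (`hWA`), Arthur–Clozel (2.2) for Borel–Jacquet data
(`h22`) and (2.3) for pairs of cuspidal data on `GL_{m_i}(𝔸_K)` for the block ranks `m_i ≥ 3` (`h23`;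
ranks `≤ 2` are theorems).  Let `ρ : Γ_K → GL_n(ℚ̄_ℓ)` be Satake–Frobenius compatible with `(π, ι)` and
`E`-rational at almost all places, and let `det(X - ρ σ) = ∏_{i<k} det(X - r_i σ)` for all `σ`, with
`k ≥ 2` blocks `r_i : Γ_K → GL_{m_i}(ℚ̄_ℓ)`, `m_i ≥ 1`.  Then some block of rank `m_i ≥ 2` admits NO
cuspidal datum on `GL_{m_i}(𝔸_K)` Satake–Frobenius compatible with it at almost all places.  Proof:
otherwise every block has such a datum `σ_i` — the rank-`≥ 2` blocks by assumption, the rank-one blocks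
by Böckle–Hui (`exists_cuspidal_compatible_of_rank_eq_one`, through a continuous semisimplification of
`ρ`) — and multiplicativity plus injectivity of the L-normalised dictionary `arithFrobPolyOfSatake ι q 1`
make `t_{π,v} = Σᵢ t_{σ_i,v}` at almost all `v`, contradicting isobaric rigidity
(`isobaricRigidity_of_JS_of_rank`, Jacquet–Shalika II Thm. 4.4).
[cite: BockleHui2025, Theorem 1.1 and §3.2.1] [cite: JacquetShalikaAJM1981II, Thm. 4.4]
[cite: CalegariGee2013, §1.1] -/
theorem exists_block_not_weaklyAutomorphic_of_rational
    (hWA : ∀ (K : Type) [Field K] [NumberField K] (h1 : isCompact_glFiniteIntegralLevel 1 K) (ℓ : ℕ) [Fact ℓ.Prime] (n : ℕ) (E : Type) [Field E] [NumberField E] (e : E →+* PadicAlgCl ℓ) (ρ : Literature.NumberTheory.GaloisRepresentations.FramedGaloisRep K (PadicAlgCl ℓ) n), ρ.toGaloisRep.IsSemisimple → (∀ᶠ v in cofinite, ρ.IsUnramifiedAt v ∧ ∃ P : Polynomial E, ρ.HasFrobCharpolyAt v (P.map e)) → ∀ (ψ : Literature.NumberTheory.GaloisRepresentations.FramedGaloisRep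 K (PadicAlgCl ℓ) 1), (∀ᶠ v in cofinite, ρ.IsUnramifiedAt v ∧ ψ.IsUnramifiedAt v ∧ ∀ 𝔓 ∈ v.primesAbove, ∀ σ : Field.absoluteGaloisGroup K, IsArithFrobAt (NumberField.RingOfIntegers K) σ 𝔓 → ψ.charpoly σ ∣ ρ.charpoly σ) → ∀ (ι : PadicAlgCl ℓ ≃+* ℂ), ∃ χ : Literature.NumberTheory.Automorphic.CuspidalAutomorphicRepData 1 K h1, χ.1.IsRegularAlgebraic ∧ ∀ᶠ v in cofinite, ∃ c : ℂ, χ.1.HasSatakeParamAt v {c} ∧ ψ.IsUnramifiedAt v ∧ ψ.HasFrobCharpolyAt v (Literature.NumberTheory.Automorphic.arithFrobPolyOfSatake ι v.residueCard 1 {c}))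
    (h22 : JacquetShalika1981_partialPairL_boundary_repData)
    {K : Type} [Field K] [NumberField K] {n : ℕ} {hcpt : isCompact_glFiniteIntegralLevel n K}
    (hn : 0 < n) (π : CuspidalAutomorphicRepData n K hcpt)
    {ℓ : ℕ} [Fact ℓ.Prime] (ι : PadicAlgCl ℓ ≃+* ℂ) {E : Type} [Field E] [NumberField E]
    (e : E →+* PadicAlgCl ℓ) (ρ : FramedGaloisRep K (PadicAlgCl ℓ) n)
    (hρ : ∀ᶠ v : HeightOneSpectrum (𝓞 K) in cofinite, SatakeFrobCompatibleAt ι π.1 ρ v)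
    (hrat : ∀ᶠ v : HeightOneSpectrum (𝓞 K) in cofinite,
      ρ.IsUnramifiedAt v ∧ ∃ P : Polynomial E, ρ.HasFrobCharpolyAt v (P.map e))
    {k : ℕ} {m : Fin k → ℕ} (hk : 2 ≤ k) (hmpos : ∀ i, 0 < m i)
    (hm : ∀ i, isCompact_glFiniteIntegralLevel (m i) K)
    (h23 : ∀ i : Fin k, 3 ≤ m i → ∀ (τ₂ τ₂' : CuspidalAutomorphicRepData (m i) K (hm i)),
      ∃ S₀ : Set (HeightOneSpectrum (𝓞 K)), S₀.Finite ∧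
        ∀ {S : Set (HeightOneSpectrum (𝓞 K))} (_hS : S.Finite) (_hS₀ : S₀ ⊆ S)
          {α β : SatakeFamily K} (_hα : ∀ w ∉ S, τ₂.1.HasSatakeParamAt w (α w))
          (_hβ : ∀ w ∉ S, τ₂'.1.HasSatakeParamAt w (β w))
          (_hu : ∀ w ∉ S, ‖(α w).prod‖ = 1) (_hu' : ∀ w ∉ S, ‖(β w).prod‖ = 1)
          {s₀ : ℂ} (_hs₀ : s₀.re = 1)
          (_hX : ∀ᶠ w in cofinite,
            (α w).map (((w.residueCard : ℂ) ^ (1 - s₀)) * ·) = (β w).map (·⁻¹)),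
          ∃ c : ℂ, c ≠ 0 ∧
            Tendsto (fun s => (s - s₀) * partialPairL S α β s) (𝓝[{s : ℂ | 1 < s.re}] s₀) (𝓝 c))
    (r : ∀ i, FramedGaloisRep K (PadicAlgCl ℓ) (m i))
    (hchar : ∀ σ, ρ.charpoly σ = ∏ i, (r i).charpoly σ) :
    ∃ i, 2 ≤ m i ∧ ∀ σ : CuspidalAutomorphicRepData (m i) K (hm i),
      ¬ ∀ᶠ v : HeightOneSpectrum (𝓞 K) in cofinite, SatakeFrobCompatibleAt ι σ.1 (r i) v := by
  by_contra H
  push Not at H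
  -- a continuous semisimplification `rs` of `ρ`: `E`-rational, same characteristic polynomials
  obtain ⟨rs, hss, hrcp, hrker⟩ := IrreducibleGL3CM.stub_continuousSemisimplification K ℓ n ρ
  have hunr : ∀ᶠ v : HeightOneSpectrum (𝓞 K) in cofinite, ρ.IsUnramifiedAt v :=
    hrat.mono fun v hv => hv.1
  have hrrat : ∀ᶠ v : HeightOneSpectrum (𝓞 K) in cofinite,
      rs.IsUnramifiedAt v ∧ ∃ P : Polynomial E, rs.HasFrobCharpolyAt v (P.map e) := by
    filter_upwards [hrat] with v hv
    obtain ⟨hur, P, hP⟩ := hv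
    exact ⟨fun 𝔓 h𝔓 σ hσ => hrker σ (hur 𝔓 h𝔓 σ hσ), P,
      fun 𝔓 h𝔓 σ hσ => (hrcp σ).trans (hP 𝔓 h𝔓 σ hσ)⟩
  have hdvd : ∀ i g, (r i).charpoly g ∣ ρ.charpoly g := fun i g => by
    rw [hchar g]
    exact Finset.dvd_prod_of_mem _ (Finset.mem_univ i)
  -- every block is a.e.-compatible with a cuspidal datum of its rank
  have hall : ∀ i, ∃ σ : CuspidalAutomorphicRepData (m i) K (hm i),
      ∀ᶠ v : HeightOneSpectrum (𝓞 K) in cofinite, SatakeFrobCompatibleAt ι σ.1 (r i) v := by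
    intro i
    by_cases h2 : 2 ≤ m i
    · exact H i h2
    · exact exists_cuspidal_compatible_of_rank_eq_one hWA e ρ rs hss hrcp hrker hrrat hunr
        (by have := hmpos i; omega) (hm i) (r i) (hdvd i) ι
  choose σ hσ using hall
  -- isobaric rigidity, with (2.3) in the block ranks (ranks `≤ 2` are theorems of the tree)
  refine isobaricRigidity_of_JS_of_rank h22 K n hcpt hn π k m hm (fun i τ₂ τ₂' => ?_) σ hk hmpos ?_
  · by_cases h3 : 3 ≤ m i
    · exact h23 i h3 τ₂ τ₂'
    · exact JacquetShalika1981_partialPairL_pole_repData_rank_of_le_two (by omega) (hm i) (hmpos i)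
        τ₂ τ₂'
  have hev : ∀ᶠ v : HeightOneSpectrum (𝓞 K) in cofinite, ∀ i, SatakeFrobCompatibleAt ι (σ i).1 (r i) v :=
    Filter.eventually_all.2 hσ
  filter_upwards [hρ, hev] with v hv hvi
  intro α hα
  obtain ⟨α₀, hα₀, -, hcpv⟩ := hv
  obtain rfl : α = α₀ := AutomorphicRepData.hasSatakeParamAt_unique_holds π.1 hα hα₀
  choose β hβ _hurβ hcpβ using hvi
  refine ⟨β, hβ, ?_⟩
  -- the Frobenius polynomial of `ρ` is the product of those of the blocks
  have hprod : ρ.HasFrobCharpolyAt v (∏ i, arithFrobPolyOfSatake ι v.residueCard 1 (β i)) := by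
    intro 𝔓 h𝔓 τ hτ
    rw [hchar τ]
    exact Finset.prod_congr rfl fun i _ => hcpβ i 𝔓 h𝔓 τ hτ
  rw [← arithFrobPolyOfSatake_sum] at hprod
  have heq : arithFrobPolyOfSatake ι v.residueCard 1 α =
      arithFrobPolyOfSatake ι v.residueCard 1 (∑ i, β i) :=
    GaloisRep.HasFrobCharpolyAt.unique_holds
      ((FramedGaloisRep.hasFrobCharpolyAt_toGaloisRep_iff v _ ρ).mpr hcpv)
      ((FramedGaloisRep.hasFrobCharpolyAt_toGaloisRep_iff v _ ρ).mpr hprod)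
  exact Literature.NumberTheory.Automorphic.arithFrobPolyOfSatake_one_injective ι _ heq

/-! ### T1: no abelian avatars -/

/-- **No `E`-rational avatar of a cuspidal `π` on `GL_n`, `n ≥ 2`, has abelian semisimplification**
(every number field `K`, EVERY cuspidal `π` — no archimedean hypothesis).  Grant Böckle–Hui 2025
Thm. 1.1 in cofinite `GL(1)` form (`hWA`) and Arthur–Clozel (2.2) for Borel–Jacquet data (`h22`).  If
`ρ : Γ_K → GL_n(ℚ̄_ℓ)` is Satake–Frobenius compatible with `(π, ι)` and `E`-rational at almost all
places, then `det(X - ρ σ)` is NOT of the form `∏_{i<n} det(X - χ_i σ)` for continuous characters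
`χ_i : Γ_K → GL_1(ℚ̄_ℓ)`: the case `k = n`, all `m_i = 1` of
`exists_block_not_weaklyAutomorphic_of_rational` ((2.3) enters in rank one only, where it is Hecke's
theorem).  Equivalently: the semisimplification of `ρ` is not a sum of characters; `ρ` is not
triangularisable over `ℚ̄_ℓ` (`exists_charpoly_eq_prod_of_isUpperTriangular`).  Rank two: Ribet.
[cite: BockleHui2025, Theorem 1.1 and §3.2.1] [cite: JacquetShalikaAJM1981II, Thm. 4.4] -/
theorem not_charpoly_eq_prod_rank_one_of_rational
    (hWA : ∀ (K : Type) [Field K] [NumberField K] (h1 : isCompact_glFiniteIntegralLevel 1 K) (ℓ : ℕ) [Fact ℓ.Prime] (n : ℕ) (E : Type) [Field E] [NumberField E] (e : E →+* PadicAlgCl ℓ) (ρ : Literature.NumberTheory.GaloisRepresentations.FramedGaloisRep K (PadicAlgCl ℓ) n), ρ.toGaloisRep.IsSemisimple → (∀ᶠ v in cofinite, ρ.IsUnramifiedAt v ∧ ∃ P : Polynomial E, ρ.HasFrobCharpolyAt v (P.map e)) → ∀ (ψ : Literature.NumberTheory.GaloisRepresentations.FramedGaloisRep K (PadicAlgCl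 ℓ) 1), (∀ᶠ v in cofinite, ρ.IsUnramifiedAt v ∧ ψ.IsUnramifiedAt v ∧ ∀ 𝔓 ∈ v.primesAbove, ∀ σ : Field.absoluteGaloisGroup K, IsArithFrobAt (NumberField.RingOfIntegers K) σ 𝔓 → ψ.charpoly σ ∣ ρ.charpoly σ) → ∀ (ι : PadicAlgCl ℓ ≃+* ℂ), ∃ χ : Literature.NumberTheory.Automorphic.CuspidalAutomorphicRepData 1 K h1, χ.1.IsRegularAlgebraic ∧ ∀ᶠ v in cofinite, ∃ c : ℂ, χ.1.HasSatakeParamAt v {c} ∧ ψ.IsUnramifiedAt v ∧ ψ.HasFrobCharpolyAt v (Literature.NumberTheory.Automorphic.arithFrobPolyOfSatake ι v.residueCard 1 {c}))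
    (h22 : JacquetShalika1981_partialPairL_boundary_repData)
    {K : Type} [Field K] [NumberField K] {n : ℕ} (hn : 2 ≤ n)
    {hcpt : isCompact_glFiniteIntegralLevel n K} (π : CuspidalAutomorphicRepData n K hcpt)
    {ℓ : ℕ} [Fact ℓ.Prime] (ι : PadicAlgCl ℓ ≃+* ℂ) {E : Type} [Field E] [NumberField E]
    (e : E →+* PadicAlgCl ℓ) (ρ : FramedGaloisRep K (PadicAlgCl ℓ) n)
    (hρ : ∀ᶠ v : HeightOneSpectrum (𝓞 K) in cofinite, SatakeFrobCompatibleAt ι π.1 ρ v)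
    (hrat : ∀ᶠ v : HeightOneSpectrum (𝓞 K) in cofinite,
      ρ.IsUnramifiedAt v ∧ ∃ P : Polynomial E, ρ.HasFrobCharpolyAt v (P.map e))
    (χ : Fin n → FramedGaloisRep K (PadicAlgCl ℓ) 1) :
    ¬ ∀ σ, ρ.charpoly σ = ∏ i, (χ i).charpoly σ := by
  intro hchar
  have h1 : isCompact_glFiniteIntegralLevel 1 K := isCompact_glFiniteIntegralLevel_holds 1 K
  obtain ⟨i, hi, -⟩ := exists_block_not_weaklyAutomorphic_of_rational hWA h22 (by omega) π ι e ρ hρ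
    hrat (m := fun _ : Fin n => 1) hn (fun _ => one_pos) (fun _ => h1)
    (fun i h3 => absurd h3 (by norm_num)) χ hchar
  exact absurd hi (by norm_num)

/-- **One `E`-rational avatar rules out abelian semisimplification for every avatar** (`n ≥ 2`).
Grant `hWA` and (2.2).  If a cuspidal `π` on `GL_n(𝔸_K)` admits ONE `ρ₀` that is Satake–Frobenius
compatible with `(π, ι)` and `E`-rational at almost all places, then NO `ρ` Satake–Frobenius compatible
with `(π, ι)` at almost all places has `det(X - ρ σ) = ∏ᵢ det(X - χ_i σ)` for continuous characters
`χ_i`: two avatars of one `π` have equal Frobenius polynomials almost everywhere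
(`eventually_hasFrobCharpolyAt_common`), so `ρ` inherits `E`-rationality from `ρ₀`.
[cite: BockleHui2025, Theorem 1.1 and §3.2.1] -/
theorem not_charpoly_eq_prod_rank_one_of_exists_rational
    (hWA : ∀ (K : Type) [Field K] [NumberField K] (h1 : isCompact_glFiniteIntegralLevel 1 K) (ℓ : ℕ) [Fact ℓ.Prime] (n : ℕ) (E : Type) [Field E] [NumberField E] (e : E →+* PadicAlgCl ℓ) (ρ : Literature.NumberTheory.GaloisRepresentations.FramedGaloisRep K (PadicAlgCl ℓ) n), ρ.toGaloisRep.IsSemisimple → (∀ᶠ v in cofinite, ρ.IsUnramifiedAt v ∧ ∃ P : Polynomial E, ρ.HasFrobCharpolyAt v (P.map e)) → ∀ (ψ : Literature.NumberTheory.GaloisRepresentations.FramedGaloisRep K (PadicAlgCl ℓ) 1), (∀ᶠ v in cofinite, ρ.IsUnramifiedAt v ∧ ψ.IsUnramifiedAt v ∧ ∀ 𝔓 ∈ v.primesAbove, ∀ σ : Field.absoluteGaloisGroup K, IsArithFrobAt (NumberField.RingOfIntegers K) σ 𝔓 → ψ.charpoly σ ∣ ρ.charpoly σ) → ∀ (ι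 : PadicAlgCl ℓ ≃+* ℂ), ∃ χ : Literature.NumberTheory.Automorphic.CuspidalAutomorphicRepData 1 K h1, χ.1.IsRegularAlgebraic ∧ ∀ᶠ v in cofinite, ∃ c : ℂ, χ.1.HasSatakeParamAt v {c} ∧ ψ.IsUnramifiedAt v ∧ ψ.HasFrobCharpolyAt v (Literature.NumberTheory.Automorphic.arithFrobPolyOfSatake ι v.residueCard 1 {c}))
    (h22 : JacquetShalika1981_partialPairL_boundary_repData)
    {K : Type} [Field K] [NumberField K] {n : ℕ} (hn : 2 ≤ n)
    {hcpt : isCompact_glFiniteIntegralLevel n K} (π : CuspidalAutomorphicRepData n K hcpt)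
    {ℓ : ℕ} [Fact ℓ.Prime] (ι : PadicAlgCl ℓ ≃+* ℂ) {E : Type} [Field E] [NumberField E]
    (e : E →+* PadicAlgCl ℓ) {ρ₀ : FramedGaloisRep K (PadicAlgCl ℓ) n}
    (hρ₀ : ∀ᶠ v : HeightOneSpectrum (𝓞 K) in cofinite, SatakeFrobCompatibleAt ι π.1 ρ₀ v)
    (hrat₀ : ∀ᶠ v : HeightOneSpectrum (𝓞 K) in cofinite,
      ρ₀.IsUnramifiedAt v ∧ ∃ P : Polynomial E, ρ₀.HasFrobCharpolyAt v (P.map e))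
    (ρ : FramedGaloisRep K (PadicAlgCl ℓ) n)
    (hρ : ∀ᶠ v : HeightOneSpectrum (𝓞 K) in cofinite, SatakeFrobCompatibleAt ι π.1 ρ v)
    (χ : Fin n → FramedGaloisRep K (PadicAlgCl ℓ) 1) :
    ¬ ∀ σ, ρ.charpoly σ = ∏ i, (χ i).charpoly σ := by
  refine not_charpoly_eq_prod_rank_one_of_rational hWA h22 hn π ι e ρ hρ ?_ χ
  filter_upwards [eventually_hasFrobCharpolyAt_common π.1 ι hρ₀ hρ, hrat₀] with v hv hv₀
  obtain ⟨-, hur, P, hP₀, hP⟩ := hv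
  obtain ⟨-, Q, hQ⟩ := hv₀
  refine ⟨hur, Q, fun 𝔓 h𝔓 τ hτ => ?_⟩
  rw [hP 𝔓 h𝔓 τ hτ, ← hP₀ 𝔓 h𝔓 τ hτ, hQ 𝔓 h𝔓 τ hτ]

end Summit.Langlands.Langlands.Theorems.IrreducibleOffSector

end
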